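import Summits.ValiantsHypothesis.ValiantsHypothesis.Theorems.GrenetZeonDualUnipotentThreeHalvesHeavyTopKrylovSeedDefs
import Summits.ValiantsHypothesis.ValiantsHypothesis.Theorems.GrenetZeonDualUnipotentThreeHalvesHeavyTopInvariantFlag
import Summits.ValiantsHypothesis.ValiantsHypothesis.Theorems.GrenetZeonDualUnipotentThreeHalvesHeavyTopFourSixTriangularisable

/-!
# `GrenetZeon.DualUnipotentThreeHalves` (stmt-ValiantsHypothesis-24318), R2 `HeavyTopLaw`, line-to-be `krylov_seed`:
# BLOCK FLAGS ARE WEIGHT FLAGS — every pencil certified by Theorem G-core / Lemma D♯ is `WeightThin` (drop `0`, climb `1`),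
# so val-idea-26's transferred crux C⁺ = `UniformWeightLaw` HOLDS on the whole invariant-flag locus of the instance table

Lead-prover preparation for the WAVE-2 line `krylov_seed` (director R280 (2): val-port-2 g2 = LEAD from registration; vocabulary = ✓
`…HeavyTopKrylovSeedDefs` (val-idea-26 g0 / val-port-3 g2): `WeightThin`, `UniformWeightLaw`).  The card's restricted sub-case
«weight-thin ⇒ flag-cheap» is ✓ `flagCheap_of_weightThin`; this file supplies the CONVERSE DIRECTION OF THE CALIBRATION: the two
certificates the instance table actually uses — Theorem G-core (✓ p645496 `flagCheap_of_block_levels`: an invariant block flag of the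
pencil + a `K` killing the diagonal blocks of the tops) and Lemma D♯ (✓ p644208 `flagCheap_of_triangularisable_sharp`: consecutive blocks of
a triangularised pencil) — are WEIGHT-THIN certificates with drop `r = 0` and climb `c = 1`, hence lie INSIDE C⁺.  So C⁺ and R2 agree on
every format/pencil decided TRUE so far, and the separating locus `FlagCheap ∧ ¬WeightThin` (the card's P3) is confined to pencils with NO
usable invariant flag — the same residual class as R2's (INSTANCES.md §7).

* `conj_linPart_apply_eq_zero` — if an entry of the conjugated PENCIL vanishes identically, the same entry of every conjugated TOP vanishes.
* ★ `weightThin_of_block_levels` — G-core's hypotheses (`hblock`, `hK`, `p·n < dim K`) give `WeightThin n m N` (with `r = 0`, `c = 1`).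
* ★ `weightThin_of_triangularisable_sharp` — D♯'s hypotheses (triangularising `P`, block size `h`,
  `((m−1)/h + 1)·n + m(h−1)/2 < n²`) give `WeightThin n m N`; instance `weightThin_four_six_of_triangularisable` (`h = 2`, `15 < 16`).

Honest framing.  Helper lemmas (`--supports stmt-ValiantsHypothesis-24318 --as helper`): calibration of C⁺ against the landed certificates;
NOTHING here proves `UniformWeightLaw`, R2 `HeavyTopLaw`, S3b, the crux `DualUnipotentThreeHalves`, rung 8062 or `VP ≠ VNP` — all OPEN / NOT
proved.  [val-idea-26's card `Cruxes/DualUnipotentThreeHalves/Ideas/krylov-seed.md`; ✓ p645496; ✓ p644208]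
-/

-- `Summit.ValiantsHypothesis.ValiantsHypothesis.…` repeats a component (D-0017 layout); `dupNamespace` would flag the mandated name.
set_option linter.dupNamespace false
set_option autoImplicit false

noncomputable section

namespace Summit.ValiantsHypothesis.ValiantsHypothesis.Theorems.GrenetZeon.KrylovSeed

open MvPolynomial Matrix
open scoped BigOperators
open Summit.ValiantsHypothesis.ValiantsHypothesis.Cruxes.TwoDimCoefficients.DimTwoCases (AffMat IsAffine)
open Summit.ValiantsHypothesis.ValiantsHypothesis.Theorems.GrenetZeon.RadicalSplit
open Summit.ValiantsHypothesis.ValiantsHypothesis.Theorems.GrenetZeon.HeavyTopInvariantFlag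
open Summit.ValiantsHypothesis.ValiantsHypothesis.Theorems.DualUnipotentThreeHalvesNegative.FlagCost

variable {m : ℕ}

/-- **Pencil entries control top entries.**  If the `(i,j)` entry of the conjugated pencil `P·N·Q` is the zero polynomial, then the
`(i,j)` entry of `P·N_lin(v)·Q` vanishes for every direction `v` (evaluate at `v` and at `0`, subtract). -/
theorem conj_linPart_apply_eq_zero {n : ℕ} (N : AffMat n m) (P Q : Matrix (Fin m) (Fin m) ℂ) (i j : Fin m)
    (h : (P.map C * N * Q.map C : AffMat n m) i j = 0) (v : Fin n × Fin n → ℂ) :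
    (P * linPart N v * Q) i j = 0 := by
  have hev : ∀ x : Fin n × Fin n → ℂ, (P * N.map (MvPolynomial.eval x) * Q) i j = 0 := by
    intro x
    have hPC : (P.map C).map (MvPolynomial.eval x) = P := by
      rw [Matrix.map_map]; ext a b; simp
    have hQC : (Q.map C).map (MvPolynomial.eval x) = Q := by
      rw [Matrix.map_map]; ext a b; simp
    have h1 := congr_arg (MvPolynomial.eval x) h
    rw [map_zero, ← Matrix.map_apply (f := MvPolynomial.eval x), Matrix.map_mul, Matrix.map_mul, hPC, hQC] at h1
    exact h1
  unfold linPart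
  rw [Matrix.mul_sub, Matrix.sub_mul, Matrix.sub_apply, hev v, hev 0, sub_zero]

/-- ★ **BLOCK FLAGS ARE WEIGHT FLAGS (Theorem G-core ⇒ weight-thin).**  Under the hypotheses of ✓ `flagCheap_of_block_levels` — the
pencil is block-upper for the level function `lvl < p` after the constant change of basis `P`, the tops `N_lin(v)`, `v ∈ K`, vanish on the
diagonal blocks, and `p·n < dim K` — the pencil is `WeightThin n m N`, with drop `r = 0` and climb `c = 1`. [this file] -/
theorem weightThin_of_block_levels {n : ℕ} (N : AffMat n m) (_hN : IsAffine N)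
    (P : (Matrix (Fin m) (Fin m) ℂ)ˣ) (lvl : Fin m → ℕ) (p : ℕ) (hp : 1 ≤ p) (hlvl : ∀ i, lvl i < p)
    (hblock : ∀ i j : Fin m, lvl i < lvl j →
      ((P : Matrix (Fin m) (Fin m) ℂ).map C * N * (↑P⁻¹ : Matrix (Fin m) (Fin m) ℂ).map C :
        Matrix (Fin m) (Fin m) (MvPolynomial (Fin n × Fin n) ℂ)) i j = 0)
    (K : Submodule ℂ (Fin n × Fin n → ℂ))
    (hK : ∀ v ∈ K, ∀ i j : Fin m, lvl i = lvl j →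
      ((P : Matrix (Fin m) (Fin m) ℂ) * linPart N v * (↑P⁻¹ : Matrix (Fin m) (Fin m) ℂ)) i j = 0)
    (hdim : p * n < Module.finrank ℂ K) :
    WeightThin n m N := by
  refine ⟨P, lvl, p, 0, 1, K, le_rfl, hlvl, ?_, ?_, ?_⟩
  · intro i j hij
    rw [add_zero] at hij
    exact hblock i j hij
  · intro v hv i j hij
    rcases lt_or_ge (lvl i) (lvl j) with hlt | hge
    · exact conj_linPart_apply_eq_zero N _ _ i j (hblock i j hlt) v
    · exact hK v hv i j (le_antisymm (by omega) hge)
  · have h5 : (p - 1 + 0 * (n - 1)) / (1 + 0) + 1 = p := by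
      rw [zero_mul, add_zero, add_zero, Nat.div_one, Nat.sub_add_cancel hp]
    rw [h5]; exact hdim

/-- ★ **LEMMA D♯ IS A WEIGHT CERTIFICATE.**  A simultaneously strictly-upper-triangularisable affine pencil with a block size `h ≥ 1` such
that `((m−1)/h + 1)·n + m(h−1)/2 < n²` is `WeightThin n m N` (consecutive blocks of size `h` as levels, `K` = tops vanishing inside the
diagonal blocks — exactly ✓ p644208's `K`, with the exact pair count ✓ `card_sameBlock_pairs_le`). [this file] -/
theorem weightThin_of_triangularisable_sharp {n : ℕ} (N : AffMat n m) (hN : IsAffine N)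
    (P : (Matrix (Fin m) (Fin m) ℂ)ˣ)
    (htri : ∀ i j : Fin m, j ≤ i →
      ((P : Matrix (Fin m) (Fin m) ℂ).map C * N * (↑P⁻¹ : Matrix (Fin m) (Fin m) ℂ).map C : AffMat n m) i j = 0)
    (h : ℕ) (hh : 1 ≤ h) (hbudget : ((m - 1) / h + 1) * n + m * (h - 1) / 2 < n ^ 2) :
    WeightThin n m N := by
  classical
  -- block levels, antitone in the index
  obtain ⟨lvl, hlvl⟩ : ∃ lvl : Fin m → ℕ, ∀ i, lvl i = (m - 1 - (i : ℕ)) / h := ⟨_, fun _ => rfl⟩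
  have hanti : ∀ i j : Fin m, i ≤ j → lvl j ≤ lvl i := fun i j hij => by
    rw [hlvl, hlvl]; exact Nat.div_le_div_right (by omega)
  -- the conjugated top as a linear map, and its same-block coordinates
  obtain ⟨T, hT⟩ : ∃ T : (Fin n × Fin n → ℂ) →ₗ[ℂ] Matrix (Fin m) (Fin m) ℂ, ∀ v,
      T v = (P : Matrix (Fin m) (Fin m) ℂ) * linPart N v * (↑P⁻¹ : Matrix (Fin m) (Fin m) ℂ) := by
    obtain ⟨T₀, hT₀⟩ := exists_topMap_linPart N hN
    refine ⟨(LinearMap.mulRight ℂ (↑P⁻¹ : Matrix (Fin m) (Fin m) ℂ)).comp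
      ((LinearMap.mulLeft ℂ (P : Matrix (Fin m) (Fin m) ℂ)).comp T₀), fun v => ?_⟩
    simp [hT₀, Matrix.mul_assoc]
  obtain ⟨L', hL'⟩ : ∃ L' : (Fin n × Fin n → ℂ) →ₗ[ℂ]
      ({q : Fin m × Fin m // q.1 < q.2 ∧ lvl q.1 = lvl q.2} → ℂ), ∀ v q, L' v q = T v q.1.1 q.1.2 := by
    refine ⟨LinearMap.pi fun q => ?_, fun v q => ?_⟩
    · exact { toFun := fun v => T v q.1.1 q.1.2
              map_add' := fun v w => by rw [map_add, Matrix.add_apply]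
              map_smul' := fun a v => by rw [map_smul, Matrix.smul_apply, smul_eq_mul, RingHom.id_apply, smul_eq_mul] }
    · rfl
  have hcard : Fintype.card {q : Fin m × Fin m // q.1 < q.2 ∧ lvl q.1 = lvl q.2} ≤ m * (h - 1) / 2 :=
    card_sameBlock_pairs_le m h hh lvl hlvl
  refine weightThin_of_block_levels N hN P lvl ((m - 1) / h + 1) (Nat.succ_pos _) (fun i => ?_) (fun i j hij => ?_)
    (LinearMap.ker L') (fun v hv i j he => ?_) ?_
  · rw [hlvl]; exact Nat.lt_succ_of_le (Nat.div_le_div_right (by omega))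
  · -- block upper: lvl i < lvl j forces j < i, a below-diagonal entry
    have hji : j ≤ i := by
      by_contra hlt
      have := hanti i j (le_of_lt (lt_of_not_ge hlt))
      omega
    exact htri i j hji
  · -- tops vanish on the diagonal blocks for v ∈ ker L'
    rcases lt_or_ge i j with hij | hji
    · have h0 := congr_fun (LinearMap.mem_ker.mp hv) ⟨(i, j), hij, he⟩
      rw [hL', Pi.zero_apply] at h0
      rw [← hT v]; exact h0
    · exact conj_linPart_apply_eq_zero N _ _ i j (htri i j hji) v
  · -- dimension
    have h1 := LinearMap.finrank_range_add_finrank_ker L'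
    have h2 : Module.finrank ℂ (LinearMap.range L') ≤
        Fintype.card {q : Fin m × Fin m // q.1 < q.2 ∧ lvl q.1 = lvl q.2} := by
      have := Submodule.finrank_le (LinearMap.range L')
      rwa [Module.finrank_fintype_fun_eq_card] at this
    have h3 : Module.finrank ℂ (Fin n × Fin n → ℂ) = n * n := by
      rw [Module.finrank_fintype_fun_eq_card, Fintype.card_prod, Fintype.card_fin]
    have h4 : n ^ 2 = n * n := sq n
    omega

/-- **`(4,6)`, triangularisable half, weight form**: every simultaneously strictly-upper-triangularisable affine `6 × 6` pencil over `ℂ^{4×4}`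
is `WeightThin 4 6` (`h = 2`: `3·4 + 3 = 15 < 16`) — C⁺ holds where ✓ `flagCheap_four_six_of_triangularisable` decided R2's instance. -/
theorem weightThin_four_six_of_triangularisable (N : AffMat 4 6) (hN : IsAffine N)
    (P : (Matrix (Fin 6) (Fin 6) ℂ)ˣ)
    (htri : ∀ i j : Fin 6, j ≤ i →
      ((P : Matrix (Fin 6) (Fin 6) ℂ).map C * N * (↑P⁻¹ : Matrix (Fin 6) (Fin 6) ℂ).map C : AffMat 4 6) i j = 0) :
    WeightThin 4 6 N :=
  weightThin_of_triangularisable_sharp N hN P htri 2 (by norm_num) (by norm_num)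

end Summit.ValiantsHypothesis.ValiantsHypothesis.Theorems.GrenetZeon.KrylovSeed

end
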